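import Mathlib.RingTheory.Flat.TorsionFree
import Mathlib.RingTheory.DiscreteValuationRing.Basic
import Mathlib.RingTheory.LocalRing.ResidueField.Basic
import Mathlib.RingTheory.Polynomial.Basic
import Mathlib.RingTheory.MvPolynomial.Basic
import HarnessLib

/-!
# [OURS · L1 W4.5(b) · EL♮(3) · door ν4 «EQUINODAL PLANAR NOSE», HSUBᵉ brick N-0, algebra half (w-iii)] A HYPERSURFACE OVER A DVR WITH NON-ZERO
# REDUCTION IS FLAT: `Module.Flat O (O[X_σ] ⧸ (G))` when `map residue G ≠ 0`

Cell `res-hironaka`, rung L, slot W4.5(b); crux CHILD EL♮(3) = stmt-ResolutionOfSingularities-20148.  WIDTH seat res-L1-w45b-nose-w1 g3, pen of HSUBᵉ (desk R58 (2));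
plan of record = res-L1-w45b-stub-2's NU4-SIZING §E (a9a266b55c2bfa46) E.1, brick **N-0** (the START row of the upstairs motive `R⁺`): its clause (w-iii)
«`Flat (𝓦.subschemeι ≫ σ' ≫ q)` for the lifted nose `𝓦₀ = 𝓘(V₊(ℓ̃, G̃))`» reduces on every affine chart of the host plane `Π_O ≅ ℙ²_O` to the statement
proved here for the dehomogenised equation (whose reduction is the dehomogenised `g|_Π ≠ 0`): over a DVR, `O[X] ⧸ (G)` is torsion-free — `a·f ∈ (G)`, `a ≠ 0`
⇒ `f ∈ (G)` by peeling off uniformisers (`ϖ f = G h` ⇒ `ḡ h̄ = 0` in the domain `k[X]`, `ḡ ≠ 0` ⇒ `h = ϖ h₁`) — hence flat (Bezout domain: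
`Module.Flat.flat_iff_torsion_eq_bot_of_isBezout`).  `--supports stmt-ResolutionOfSingularities-20148 --as helper`, counted 0.  OURS; nothing of [Hironaka2017];
AI-written, weaker than expert review; DEF-FREE, no `sorry`, standard axioms; EL♮(3) NOT proved; resolution in positive characteristic NOT proved.
-/

set_option linter.dupNamespace false

noncomputable section

open MvPolynomial IsLocalRing

namespace Summit.ResolutionOfSingularities.ResolutionOfSingularities.Cruxes.EquisingularLiftNat.Sections.Equinodal

/-- Over a DVR `O` with uniformiser `ϖ`: if `ϖ · f ∈ (G)` in `O[X_σ]` and `G` does not reduce to `0` modulo `𝔪`, then `f ∈ (G)`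
(reduce `ϖ f = G h` modulo `𝔪`: `ḡ h̄ = 0` in the domain `k[X]` with `ḡ ≠ 0`, so `h = ϖ h₁` and `f = G h₁`). [folklore] -/
theorem mem_span_of_uniformizer_mul_mem {O : Type*} [CommRing O] [IsDomain O] [IsDiscreteValuationRing O] {σ : Type*}
    {ϖ : O} (hϖ : Irreducible ϖ) (G : MvPolynomial σ O) (hG : map (residue O) G ≠ 0)
    (f : MvPolynomial σ O) (hf : C ϖ * f ∈ Ideal.span {G}) : f ∈ Ideal.span {G} := by
  obtain ⟨h, hh⟩ := Ideal.mem_span_singleton'.mp hf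
  -- reduce modulo `𝔪 = (ϖ)`
  have hred : map (residue O) h * map (residue O) G = 0 := by
    rw [← map_mul, hh, map_mul, map_C]
    have : residue O ϖ = 0 := (residue_eq_zero_iff ϖ).mpr (hϖ.maximalIdeal_eq ▸ Ideal.mem_span_singleton_self ϖ)
    rw [this, C_0, zero_mul]
  have hh0 : map (residue O) h = 0 := by
    rcases mul_eq_zero.mp hred with h0 | h0
    · exact h0
    · exact absurd h0 hG
  -- so `h ∈ ker (map residue) = (C ϖ)`
  have hker : h ∈ RingHom.ker (map (residue O) : MvPolynomial σ O →+* MvPolynomial σ (ResidueField O)) := hh0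
  rw [ker_map, ker_residue, hϖ.maximalIdeal_eq, Ideal.map_span, Set.image_singleton] at hker
  obtain ⟨h₁, hh₁⟩ := Ideal.mem_span_singleton'.mp hker
  -- cancel `ϖ`
  have hCϖ : (C ϖ : MvPolynomial σ O) ≠ 0 := by
    rw [Ne, C_eq_zero]; exact hϖ.ne_zero
  have : f = h₁ * G := by
    apply mul_left_cancel₀ hCϖ
    rw [← hh, ← hh₁]; ring
  exact Ideal.mem_span_singleton'.mpr ⟨h₁, this.symm⟩

/-- **A hypersurface over a DVR with non-zero reduction is flat.**  For a DVR `O` and `G ∈ O[X_σ]` with `map residue G ≠ 0` (some coefficient a unit),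
`O[X_σ] ⧸ (G)` is a FLAT `O`-module (torsion-free over a Bezout domain: `a f ∈ (G)`, `a ≠ 0` ⇒ `f ∈ (G)` by peeling off uniformisers).  This is the
algebraic core of «the lifted nose `V(ℓ̃, G̃) ⊂ ℙ³_O` is `O`-flat» (NU4-SIZING §E (w-iii)) on every affine chart. [folklore] -/
theorem flat_quotient_span_of_map_residue_ne_zero {O : Type*} [CommRing O] [IsDomain O] [IsDiscreteValuationRing O] {σ : Type*}
    (G : MvPolynomial σ O) (hG : map (residue O) G ≠ 0) :
    Module.Flat O (MvPolynomial σ O ⧸ Ideal.span {G}) := by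
  classical
  obtain ⟨ϖ, hϖ⟩ := IsDiscreteValuationRing.exists_irreducible O
  rw [Module.Flat.flat_iff_torsion_eq_bot_of_isBezout, Submodule.eq_bot_iff]
  intro x hx
  obtain ⟨⟨a, ha⟩, hax⟩ := (Submodule.mem_torsion_iff x).mp hx
  obtain ⟨f, rfl⟩ := Ideal.Quotient.mk_surjective x
  have ha0 : a ≠ 0 := nonZeroDivisors.ne_zero ha
  obtain ⟨n, u, rfl⟩ := IsDiscreteValuationRing.eq_unit_mul_pow_irreducible ha0 hϖ
  -- `(u ϖⁿ) • [f] = 0` means `C (u ϖⁿ) * f ∈ (G)`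
  have hmem : C ((u : O) * ϖ ^ n) * f ∈ Ideal.span {G} := by
    have h1 : ((u : O) * ϖ ^ n) • (Ideal.Quotient.mkₐ O (Ideal.span {G}) f) = 0 := hax
    rw [← map_smul, Ideal.Quotient.mkₐ_eq_mk, Ideal.Quotient.eq_zero_iff_mem, Algebra.smul_def, algebraMap_eq] at h1
    exact h1
  -- peel off the unit and the uniformisers one at a time
  have hpeel : ∀ (m : ℕ) (g : MvPolynomial σ O), C ϖ ^ m * g ∈ Ideal.span {G} → g ∈ Ideal.span {G} := by
    intro m
    induction m with
    | zero => intro g hg; simpa using hg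
    | succ m ih =>
      intro g hg
      apply ih
      apply mem_span_of_uniformizer_mul_mem hϖ G hG
      rw [← mul_assoc, ← pow_succ']
      exact hg
  have hunit : IsUnit (C (u : O) : MvPolynomial σ O) := (u.isUnit).map C
  have hmem' : C ϖ ^ n * f ∈ Ideal.span {G} := by
    rw [map_mul, map_pow, mul_assoc] at hmem
    exact (Ideal.unit_mul_mem_iff_mem _ hunit).mp hmem
  have hf : f ∈ Ideal.span {G} := hpeel n f hmem'
  exact (Ideal.Quotient.eq_zero_iff_mem).mpr hf

end Summit.ResolutionOfSingularities.ResolutionOfSingularities.Cruxes.EquisingularLiftNat.Sections.Equinodal
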